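import Summits.BirchSwinnertonDyer.BirchSwinnertonDyer.Theorems.EdixhovenFibreFiveSevenMemberManinUnitFiveSevenGlue
import Summits.BirchSwinnertonDyer.BirchSwinnertonDyer.Theorems.AdditiveKolyvaginRoadManinFrameResidueProperRTameTwistFull57
import Summits.BirchSwinnertonDyer.Rank1Residual.Additive.GordTorsionFiveSeven
import Summits.BirchSwinnertonDyer.BirchSwinnertonDyer.Theorems.AdditiveKolyvaginRoadManinFrameResidueProperCremonaRange
import HarnessLib

/-!
# Route `EdixhovenFibreFiveSeven`, crux TDS57 `TwistDegreeStepFiveSeven` (stmt-BirchSwinnertonDyer-22227):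
# the twist-degree step at `p ∈ {5, 7}` IS Manin's `p`-part for the unstarred curves, and GRANTED Kato's
# integral zeta elements in Néron units (F″) it holds off the Kosters–Pannekoek sub-residue — `--supports`

Cell `pub/bsd-wall` (D-0145 line `route-BirchSwinnertonDyer-EdixhovenFibreFiveSeven`), seat
`bsd-line-edix-p2` (prover). THEOREMS ONLY (no definition, no named fact, no `sorry`); nothing is closed
and BSD is not proved by this file. TDS57 says: for `p ∈ {5, 7}` and `V/ℚ` globally minimal, additive at
`p` of Kodaira type II/III/IV (`ord_p Δ_min(V) ≤ 4`, no `Iₙ*` fibre), `E[p]` irreducible, and `W♭` a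
globally minimal model of `V ⊗ χ_{p*}`: SOME conductor-level datum `D` of `V` has `v_p(deg D) <
v_p(deg D♭)` for EVERY conductor-level datum `D♭` of `W♭` (Edixhoven 1991 §4 "case 2").

* §1 `padicVal_modularDegree_lt_of_not_dvd_c'` — a conductor-level datum `D` of `V` with `p ∤ c(D)`
  gives the step against every `D♭` (the cell's twist identity
  `v_p(deg D♭) + 2v_p(c(D)) = v_p(deg D) + 2v_p(c(D♭)) + 1`, `Additive.padicVal_twist_identity`; the
  (G)-ordinary hypothesis of p540328's version is replaced by `0 ≤ ord_p j`, automatic off `Iₙ*`).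
* §2 `twistDegreeStepFiveSeven_of_unstarredManinUnit` — **TDS57 ⟸ U57**, where U57 (a hypothesis,
  spelled out) = "every such `V` has a conductor-level datum with `p ∤ c`"; modularity is not even used.
  `exists_datum_not_dvd_c_of_twistDegreeStepFiveSeven` — **U57 ⟸ TDS57** per curve, GRANTED modularity,
  Dokchitser–Dokchitser and K★ (the unstarred side of the landed glue p580107, transported back to `V`
  prime-to-`p`). So, granted `hnf + hDD + K★`, TDS57 ⟺ U57: the crux is Manin's `p`-part (some datum) for
  the UNSTARRED additive curves at `p ∈ {5, 7}` with `E[p]` irreducible — nothing about degrees is lost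
  or gained.
* §3 `twistDegreeStep57_of_kato_of_noTorsion` — **the step at `(p, V, W♭)` GRANTED F″**
  (`kato_neron_isIntegral_twistedSymbolSum_of_additive_five_le`, cite-only, p576988) **and modularity,
  whenever no member of the class of `V` has a `ℚ_p`-rational point of order `p`**: the AKR tame-twist
  lever at `p ∈ {5, 7}` (`ManinFrameResidueProperRTameTwist.exists_member_not_dvd_c_of_tameTwist57`,
  seat bsd-wall-manin-p1 g4) + prime-to-`p` transport + §1.
  `twistDegreeStep57_of_kato_of_kodaira_IV_or_III_at_seven` — the torsion hypothesis DISCHARGED on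
  Kodaira type IV (`ord_p Δ_min = 4`, `p ∈ {5, 7}`) and on type III at `p = 7` (`ord_7 Δ_min = 3`):
  `p`-torsion in `E(ℚ_p)` at an additive `p ≥ 5` forces `(p, ord_p Δ_min) ∈ {(5,2), (5,3), (7,2)}`
  (Mazur 1977 III §5 Step 1, tree `GordTorsionFiveSeven`), and `ord_p Δ_min` is a class invariant under
  `Irr` on the potentially good locus (Dokchitser–Dokchitser, `hDD`).
* §4 `twistDegreeStepFiveSeven_of_kato_of_kpResidue` — **TDS57 BY NAME ⟸ F″ ∧ KP57**, KP57 (a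
  hypothesis, spelled out) = "U57 on the Kosters–Pannekoek sub-residue": every `V` as in TDS57 whose
  class contains a member with a `ℚ_p`-rational point of order `p` has a conductor-level datum with
  `p ∤ c`. By §3 such `V` have `(p, type) ∈ {(5, II), (5, III), (7, II)}`
  (`kp_types_of_torsion_witness`). THIS is the open content of TDS57 given F″.

* §5 (appended) the ČNS degree sub-locus, Cremona's range, and **TDS57 BY NAME ⟸ F″ ∧ ČNS ∧ Cremona
  ∧ KP57♯** (KP57♯ = U57 on: a `ℚ_p`-rational `p`-torsion point in the class ∧ all conductor-level degrees
  divisible by `p` ∧ `N > 5·10⁵`) — the residue of the crux after every lever in the tree.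

References: [EdixhovenManin1991] Progr. Math. 89 (1991) §4 (typescript L1052–1068, L1158–1167);
[ZagierCMB1985] §1; [Kato2004Asterisque] (8.1.3), Thm. 9.7, Thm. 6.6 (1); [KimNakamura2020] Cor. 2.4;
[KostersPannekoek2017] Thm. 1, Cor. 2; [Mazur1977] Ch. III §5 Step 1 (p. 158);
[DokchitserDokchitser2015LocalInvariants] Thm. 5.1 (1).
-/

set_option autoImplicit false
-- the Theorems directory repeats the summit name (sibling precedent `SignedBaseChangeAssembly.lean`)
set_option linter.dupNamespace false

noncomputable section

open scoped Classical

open WeierstrassCurve NumberField Literature.NumberTheory.EllipticCurves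
  Literature.NumberTheory.EllipticCurves.ModularForms
  Literature.NumberTheory.EllipticCurves.Rank1Residual
  Literature.NumberTheory.DiophantineGeometry IsDedekindDomain Rat.HeightOneSpectrum
  Summit.BirchSwinnertonDyer.Rank1Residual Summit.BirchSwinnertonDyer.Rank1Residual.Additive
  Summit.BirchSwinnertonDyer.BirchSwinnertonDyer.Theorems
  Summit.BirchSwinnertonDyer.BirchSwinnertonDyer.Theses.EdixhovenFibreFiveSeven

namespace Summit.BirchSwinnertonDyer.BirchSwinnertonDyer.Theorems.TwistDegreeStepFiveSeven

/-! ### §1 One Manin-unit datum of `V` gives the step against every datum of the twist -/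

section Identity

variable {p : ℕ} [hp : Fact p.Prime]

/-- **`p ∤ c(D)` forces `v_p(deg D) < v_p(deg D♭)` for EVERY conductor-level datum `D♭` of the
`p*`-twist** (`p ≥ 5`; `V` additive and potentially good at `p` with `ord_p Δ_min(V) ≤ 4`, `W♭` a globally
minimal model of `V ⊗ χ_{p*}`): the twist identity `v_p(deg D♭) + 2·v_p(c(D)) = v_p(deg D) + 2·v_p(c(D♭))
+ 1` (`Additive.padicVal_twist_identity`) read with `v_p(c(D)) = 0`. (p540328's
`padicVal_modularDegree_lt_of_not_dvd_c` with `TypeGOrd` replaced by `0 ≤ ord_p j`.)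
[cite: ZagierCMB1985, §1 (p. 374)] [cite: Watkins2002, §2.1 (p. 491)] -/
theorem padicVal_modularDegree_lt_of_not_dvd_c' (hp5 : 5 ≤ p) (V Wf : WeierstrassCurve ℚ)
    [V.IsElliptic] [V.IsGloballyMinimal] [Wf.IsElliptic] [Wf.IsGloballyMinimal] (hV : Addv V p)
    (hj : 0 ≤ padicValRat p V.j) (hV4 : padicValInt p V.minimalDiscriminantInt ≤ 4)
    (C : VariableChange ℚ) (hC : C • V.quadraticTwist ((-1 : ℚ) ^ (p / 2) * p) = Wf)
    [NeZero (V.conductorNorm ℤ)] [NeZero (Wf.conductorNorm ℤ)]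
    (D : ModularParametrizationData V (V.conductorNorm ℤ)) (hc : ¬ (p : ℤ) ∣ D.c)
    (Df : ModularParametrizationData Wf (Wf.conductorNorm ℤ)) :
    padicValNat p D.modularDegree < padicValNat p Df.modularDegree := by
  have hV6 : padicValInt p V.minimalDiscriminantInt < 6 := by omega
  have h := padicVal_twist_identity p hp5 V Wf hV hj hV6 C hC D Df
  have hc0 : padicValInt p D.maninConstant = 0 := padicValInt.eq_zero_of_not_dvd hc
  omega

/-- **A conductor-level datum of `V` with `p ∤ c` gives the twist-degree step at `(V, W♭)`** for `V`
additive at `p ≥ 5` of Kodaira type II/III/IV without `Iₙ*` fibre (so potentially good, landed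
`MemberManinUnitFiveSevenGlue.padicValRat_j_nonneg_of_forall_ne_Istar`). [cite: ZagierCMB1985, §1 (p. 374)] -/
theorem twistDegreeStep57_of_not_dvd_c (hp5 : 5 ≤ p) (V Wf : WeierstrassCurve ℚ)
    [V.IsElliptic] [V.IsGloballyMinimal] [Wf.IsElliptic] [Wf.IsGloballyMinimal]
    [NeZero (V.conductorNorm ℤ)] [NeZero (Wf.conductorNorm ℤ)] (hV : Addv V p)
    (hK : ∀ (v : HeightOneSpectrum ℤ) (n : ℕ), natGenerator v = p →
      V.kodairaSymbolAt v ≠ KodairaSymbol.Istar n)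
    (hV4 : padicValInt p V.minimalDiscriminantInt ≤ 4)
    (C : VariableChange ℚ) (hC : C • V.quadraticTwist ((-1 : ℚ) ^ (p / 2) * p) = Wf)
    (D : ModularParametrizationData V (V.conductorNorm ℤ)) (hc : ¬ (p : ℤ) ∣ D.c) :
    ∀ Df : ModularParametrizationData Wf (Wf.conductorNorm ℤ),
      padicValNat p D.modularDegree < padicValNat p Df.modularDegree := by
  have hp2 : p ≠ 2 := by omega
  have hj : 0 ≤ padicValRat p V.j :=
    MemberManinUnitFiveSevenGlue.padicValRat_j_nonneg_of_forall_ne_Istar V hp2 hV hK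
  exact fun Df ↦ padicVal_modularDegree_lt_of_not_dvd_c' hp5 V Wf hV hj hV4 C hC D hc Df

end Identity

/-! ### §2 TDS57 ⟺ U57 (Manin's `p`-part, some datum, for the unstarred curves at `p ∈ {5, 7}`) -/

/-- **TDS57 ⟸ U57.** If every globally minimal `V/ℚ`, additive at `p ∈ {5, 7}` with `E[p]` irreducible,
no `Iₙ*` fibre and `ord_p Δ_min(V) ≤ 4`, has a conductor-level parametrisation datum with `p ∤ c`, then
TDS57 holds — by §1; modularity (`exists_isNewformOf`, the item's first binder) is not used.
[cite: EdixhovenManin1991, §4 (case 2)] [cite: ZagierCMB1985, §1 (p. 374)] -/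
theorem twistDegreeStepFiveSeven_of_unstarredManinUnit
    (hU : ∀ (p : ℕ) [Fact p.Prime] (V : WeierstrassCurve ℚ) [V.IsElliptic] [V.IsGloballyMinimal]
      [NeZero (V.conductorNorm ℤ)], (p = 5 ∨ p = 7) → Addv V p → Irr V p →
      (∀ (v : HeightOneSpectrum ℤ) (n : ℕ), natGenerator v = p →
        V.kodairaSymbolAt v ≠ KodairaSymbol.Istar n) →
      padicValInt p V.minimalDiscriminantInt ≤ 4 →
      ∃ D : ModularParametrizationData V (V.conductorNorm ℤ), ¬ (p : ℤ) ∣ D.c) :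
    TwistDegreeStepFiveSeven := by
  intro _hnf p _ V _ _ _ Wf _ _ _ C hp57 hadd hirr hK hV4 hC
  obtain ⟨D, hc⟩ := hU p V hp57 hadd hirr hK hV4
  exact ⟨D, twistDegreeStep57_of_not_dvd_c (by omega) V Wf hadd hK hV4 C hC D hc⟩

/-- **U57 ⟸ TDS57, per curve, GRANTED modularity, Dokchitser–Dokchitser and K★**: for `V/ℚ` globally
minimal, additive at `p ∈ {5, 7}` with `E[p]` irreducible, no `Iₙ*` fibre and `ord_p Δ_min(V) ≤ 4`, some
conductor-level datum of `V` has `p ∤ c` — the unstarred side of the glue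
(`MemberManinUnitFiveSevenGlue.exists_member_not_dvd_c_of_le_four`, p580107: K★ at the optimal member of
the twisted class, transport, TDS57, twist identity) followed by prime-to-`p` transport of the member's
datum back to `V` (`ManinFrameTransport.exists_modularParametrizationData_not_dvd_of_partner`).
[cite: EdixhovenManin1991, Thm. 3 and §4] [cite: DokchitserDokchitser2015LocalInvariants, Thm. 5.1 (1)]
[cite: JetchevSkinnerWan2017, §7.4.1 and Remark 43] -/
theorem exists_datum_not_dvd_c_of_twistDegreeStepFiveSeven (hnf : exists_isNewformOf)
    (hDD : dokchitser_padicValInt_minimalDiscriminantInt_eq_of_isogeny_of_not_dvd_degree)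
    (hS : StarredOptimalManinUnitFiveSeven) (hT : TwistDegreeStepFiveSeven)
    {p : ℕ} [hp : Fact p.Prime] (V : WeierstrassCurve ℚ) [V.IsElliptic] [V.IsGloballyMinimal]
    [NeZero (V.conductorNorm ℤ)] (hp57 : p = 5 ∨ p = 7) (hadd : Addv V p) (hirr : Irr V p)
    (hK : ∀ (v : HeightOneSpectrum ℤ) (n : ℕ), natGenerator v = p →
      V.kodairaSymbolAt v ≠ KodairaSymbol.Istar n)
    (hV4 : padicValInt p V.minimalDiscriminantInt ≤ 4) :
    ∃ D : ModularParametrizationData V (V.conductorNorm ℤ), ¬ (p : ℤ) ∣ D.c := by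
  obtain ⟨W₀, hE₀, hM₀, D₀, hiso, hc₀⟩ :=
    MemberManinUnitFiveSevenGlue.exists_member_not_dvd_c_of_le_four hnf hDD hS hT V hp57 hadd hirr hK hV4
  haveI := hE₀
  haveI := hM₀
  exact ManinFrameTransport.exists_modularParametrizationData_not_dvd_of_partner V hp.out hirr hiso D₀ hc₀

/-! ### §3 GRANTED F″: the step off the Kosters–Pannekoek sub-residue -/

section Kato

variable {p : ℕ} [hp : Fact p.Prime]

/-- **The step at `(p, V, W♭)` GRANTED F″ and modularity, when no member of the class of `V` has a
`ℚ_p`-rational point of order `p`.** The tame-twist lever at `p ∈ {5, 7}`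
(`ManinFrameResidueProperRTameTwist.exists_member_not_dvd_c_of_tameTwist57`: F″ + `Addv` + `Irr` + no
`p`-torsion along the class ⟹ the `X₀(N)`-optimal member has `p ∤ c₀`), prime-to-`p` transport to `V`,
then §1. [cite: Kato2004Asterisque, (8.1.3) (p. 180), Thm. 9.7 (p. 189)] [cite: KimNakamura2020, Cor. 2.4]
[cite: KostersPannekoek2017, Thm. 1 and Cor. 2] [cite: ZagierCMB1985, §1 (p. 374)] -/
theorem twistDegreeStep57_of_kato_of_noTorsion
    (hF : kato_neron_isIntegral_twistedSymbolSum_of_additive_five_le) (hnf : exists_isNewformOf)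
    (V : WeierstrassCurve ℚ) [V.IsElliptic] [V.IsGloballyMinimal] [NeZero (V.conductorNorm ℤ)]
    (Wf : WeierstrassCurve ℚ) [Wf.IsElliptic] [Wf.IsGloballyMinimal] [NeZero (Wf.conductorNorm ℤ)]
    (C : VariableChange ℚ) (hp57 : p = 5 ∨ p = 7) (hadd : Addv V p) (hirr : Irr V p)
    (hK : ∀ (v : HeightOneSpectrum ℤ) (n : ℕ), natGenerator v = p →
      V.kodairaSymbolAt v ≠ KodairaSymbol.Istar n)
    (hV4 : padicValInt p V.minimalDiscriminantInt ≤ 4)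
    (hC : C • V.quadraticTwist ((-1 : ℚ) ^ (p / 2) * p) = Wf)
    (hPT : ∀ (W' : WeierstrassCurve ℚ) [W'.IsElliptic] [W'.IsGloballyMinimal], IsIsogenous V W' →
      ∀ P : (W'.baseChange ℚ_[p]).toAffine.Point, p • P = 0 → P = 0) :
    ∃ D : ModularParametrizationData V (V.conductorNorm ℤ),
      ∀ Df : ModularParametrizationData Wf (Wf.conductorNorm ℤ),
        padicValNat p D.modularDegree < padicValNat p Df.modularDegree := by
  obtain ⟨W₀, hE₀, hM₀, D₀, hiso, hc₀⟩ :=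
    ManinFrameResidueProperRTameTwist.exists_member_not_dvd_c_of_tameTwist57 hF hnf V hp57 hadd hirr hPT
  haveI := hE₀
  haveI := hM₀
  obtain ⟨D, hc⟩ :=
    ManinFrameTransport.exists_modularParametrizationData_not_dvd_of_partner V hp.out hirr hiso D₀ hc₀
  exact ⟨D, twistDegreeStep57_of_not_dvd_c (by omega) V Wf hadd hK hV4 C hC D hc⟩

/-- **The torsion hypothesis holds along the class on Kodaira type IV (`p ∈ {5, 7}`) and type III at
`p = 7`**: for `V` globally minimal, additive at `p ≥ 5` with `E[p]` irreducible and potentially good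
(`0 ≤ ord_p j`), with `ord_p Δ_min(V) = 4`, or `p = 7` and `ord_7 Δ_min(V) = 3`, NO globally minimal
`W' ∼ V` has a `ℚ_p`-rational point of order `p`: `ord_p Δ_min(W') = ord_p Δ_min(V)` (Dokchitser–Dokchitser
along a cyclic isogeny, prime to `p` under `Irr`), `W'` is additive at `p`, and a point of order `p` in
`E'(ℚ_p)` forces `(p, ord_p Δ_min) ∈ {(5, 2), (5, 3), (7, 2)}` (Mazur 1977 III §5 Step 1).
[cite: Mazur1977, Ch. III §5, Step 1, p. 158] [cite: DokchitserDokchitser2015LocalInvariants, Thm. 5.1 (1)] -/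
theorem forall_member_noTorsion_of_kodaira_IV_or_III_at_seven
    (hDD : dokchitser_padicValInt_minimalDiscriminantInt_eq_of_isogeny_of_not_dvd_degree)
    (V : WeierstrassCurve ℚ) [V.IsElliptic] [V.IsGloballyMinimal] (hp5 : 5 ≤ p) (hadd : Addv V p)
    (hirr : Irr V p) (hj : 0 ≤ padicValRat p V.j)
    (hv : padicValInt p V.minimalDiscriminantInt = 4 ∨
      (p = 7 ∧ padicValInt p V.minimalDiscriminantInt = 3)) :
    ∀ (W' : WeierstrassCurve ℚ) [W'.IsElliptic] [W'.IsGloballyMinimal], IsIsogenous V W' →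
      ∀ P : (W'.baseChange ℚ_[p]).toAffine.Point, p • P = 0 → P = 0 := by
  intro W' _ _ hiso P hP
  have hadd' : Addv W' p := (X2.addv_iff_of_isIsogenous (p := p) hiso).mp hadd
  have hv' : padicValInt p W'.minimalDiscriminantInt = padicValInt p V.minimalDiscriminantInt := by
    obtain ⟨ψ, hψ⟩ := hiso.exists_isCyclic
    have hdeg : ¬ p ∣ ψ.degree := X11b.not_dvd_degree_of_isCyclic_of_irr ψ hψ hp.out hirr
    exact (hDD V W' ψ p hp.out hdeg hj).symm
  by_contra hP0
  have hP' : (p : ℤ) • P = 0 := by rw [natCast_zsmul]; exact hP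
  rcases padicValInt_minimalDiscriminantInt_of_prime_zsmul_eq_zero_of_addv W' p hp5 hadd' hP0 hP'
    with ⟨h5, h | h⟩ | ⟨h7, h⟩ <;> omega

/-- **The step at `(p, V, W♭)` GRANTED F″, modularity and Dokchitser–Dokchitser, on Kodaira type IV
(`p ∈ {5, 7}`) and on type III at `p = 7`** — the torsion hypothesis of
`twistDegreeStep57_of_kato_of_noTorsion` discharged by `forall_member_noTorsion_of_kodaira_IV_or_III_at_seven`.
So, given F″, TDS57 is a theorem at `(7, III)`, `(7, IV)`, `(5, IV)`; what remains is `(5, II)`, `(5, III)`,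
`(7, II)` — and there only the classes with a `ℚ_p`-rational `p`-torsion point (§4).
[cite: Kato2004Asterisque, Thm. 9.7 (p. 189)] [cite: Mazur1977, Ch. III §5, Step 1, p. 158]
[cite: DokchitserDokchitser2015LocalInvariants, Thm. 5.1 (1)] -/
theorem twistDegreeStep57_of_kato_of_kodaira_IV_or_III_at_seven
    (hF : kato_neron_isIntegral_twistedSymbolSum_of_additive_five_le) (hnf : exists_isNewformOf)
    (hDD : dokchitser_padicValInt_minimalDiscriminantInt_eq_of_isogeny_of_not_dvd_degree)
    (V : WeierstrassCurve ℚ) [V.IsElliptic] [V.IsGloballyMinimal] [NeZero (V.conductorNorm ℤ)]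
    (Wf : WeierstrassCurve ℚ) [Wf.IsElliptic] [Wf.IsGloballyMinimal] [NeZero (Wf.conductorNorm ℤ)]
    (C : VariableChange ℚ) (hp57 : p = 5 ∨ p = 7) (hadd : Addv V p) (hirr : Irr V p)
    (hK : ∀ (v : HeightOneSpectrum ℤ) (n : ℕ), natGenerator v = p →
      V.kodairaSymbolAt v ≠ KodairaSymbol.Istar n)
    (hv : padicValInt p V.minimalDiscriminantInt = 4 ∨
      (p = 7 ∧ padicValInt p V.minimalDiscriminantInt = 3))
    (hC : C • V.quadraticTwist ((-1 : ℚ) ^ (p / 2) * p) = Wf) :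
    ∃ D : ModularParametrizationData V (V.conductorNorm ℤ),
      ∀ Df : ModularParametrizationData Wf (Wf.conductorNorm ℤ),
        padicValNat p D.modularDegree < padicValNat p Df.modularDegree := by
  have hp5 : 5 ≤ p := by omega
  have hp2 : p ≠ 2 := by omega
  have hj : 0 ≤ padicValRat p V.j :=
    MemberManinUnitFiveSevenGlue.padicValRat_j_nonneg_of_forall_ne_Istar V hp2 hadd hK
  have hV4 : padicValInt p V.minimalDiscriminantInt ≤ 4 := by omega
  exact twistDegreeStep57_of_kato_of_noTorsion hF hnf V Wf C hp57 hadd hirr hK hV4 hC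
    (forall_member_noTorsion_of_kodaira_IV_or_III_at_seven hDD V hp5 hadd hirr hj hv)

/-- **Where the Kosters–Pannekoek sub-residue sits**: if `V` is globally minimal, additive at `p ≥ 5` with
`E[p]` irreducible and potentially good, and SOME globally minimal `W' ∼ V` has a `ℚ_p`-rational point of
order `p`, then `(p, ord_p Δ_min(V)) ∈ {(5, 2), (5, 3), (7, 2)}` — Kodaira II or III at `5`, II at `7`.
[cite: Mazur1977, Ch. III §5, Step 1, p. 158] [cite: DokchitserDokchitser2015LocalInvariants, Thm. 5.1 (1)] -/
theorem kp_types_of_torsion_witness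
    (hDD : dokchitser_padicValInt_minimalDiscriminantInt_eq_of_isogeny_of_not_dvd_degree)
    (V : WeierstrassCurve ℚ) [V.IsElliptic] [V.IsGloballyMinimal] (hp5 : 5 ≤ p) (hadd : Addv V p)
    (hirr : Irr V p) (hj : 0 ≤ padicValRat p V.j)
    {W' : WeierstrassCurve ℚ} [W'.IsElliptic] [W'.IsGloballyMinimal] (hiso : IsIsogenous V W')
    {P : (W'.baseChange ℚ_[p]).toAffine.Point} (hP0 : P ≠ 0) (hP : p • P = 0) :
    (p = 5 ∧ (padicValInt p V.minimalDiscriminantInt = 2 ∨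
        padicValInt p V.minimalDiscriminantInt = 3)) ∨
      (p = 7 ∧ padicValInt p V.minimalDiscriminantInt = 2) := by
  have hadd' : Addv W' p := (X2.addv_iff_of_isIsogenous (p := p) hiso).mp hadd
  have hv' : padicValInt p W'.minimalDiscriminantInt = padicValInt p V.minimalDiscriminantInt := by
    obtain ⟨ψ, hψ⟩ := hiso.exists_isCyclic
    have hdeg : ¬ p ∣ ψ.degree := X11b.not_dvd_degree_of_isCyclic_of_irr ψ hψ hp.out hirr
    exact (hDD V W' ψ p hp.out hdeg hj).symm
  have hP' : (p : ℤ) • P = 0 := by rw [natCast_zsmul]; exact hP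
  rw [← hv']
  exact padicValInt_minimalDiscriminantInt_of_prime_zsmul_eq_zero_of_addv W' p hp5 hadd' hP0 hP'

end Kato

/-! ### §4 TDS57 BY NAME ⟸ F″ ∧ (U57 on the Kosters–Pannekoek sub-residue) -/

/-- **TDS57 `TwistDegreeStepFiveSeven` (stmt-BirchSwinnertonDyer-22227) GRANTED F″ and KP57.** F″ =
`kato_neron_isIntegral_twistedSymbolSum_of_additive_five_le` (cite-only, p576988). KP57 (hypothesis `hKP`,
spelled out; OPEN, not in print) = Manin's `p`-part, SOME conductor-level datum, for every globally
minimal `V/ℚ` additive at `p ∈ {5, 7}` with `E[p]` irreducible, no `Iₙ*` fibre, `ord_p Δ_min(V) ≤ 4`, whose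
isogeny class contains a globally minimal member with a `ℚ_p`-RATIONAL POINT OF ORDER `p` (the
Kosters–Pannekoek sub-residue; by `kp_types_of_torsion_witness` only Kodaira II/III at `5` and II at `7`
occur). Off KP57 the lever of §3 applies. CONDITIONAL: the item is not closed; BSD is not proved by this.
[cite: Kato2004Asterisque, (8.1.3) (p. 180), Thm. 9.7 (p. 189)] [cite: KostersPannekoek2017, Thm. 1 and Cor. 2]
[cite: EdixhovenManin1991, §4 (cases 1/2)] -/
theorem twistDegreeStepFiveSeven_of_kato_of_kpResidue
    (hF : kato_neron_isIntegral_twistedSymbolSum_of_additive_five_le)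
    (hKP : ∀ (p : ℕ) [Fact p.Prime] (V : WeierstrassCurve ℚ) [V.IsElliptic] [V.IsGloballyMinimal]
      [NeZero (V.conductorNorm ℤ)], (p = 5 ∨ p = 7) → Addv V p → Irr V p →
      (∀ (v : HeightOneSpectrum ℤ) (n : ℕ), natGenerator v = p →
        V.kodairaSymbolAt v ≠ KodairaSymbol.Istar n) →
      padicValInt p V.minimalDiscriminantInt ≤ 4 →
      (∃ (W' : WeierstrassCurve ℚ) (_ : W'.IsElliptic) (_ : W'.IsGloballyMinimal)
        (P : (W'.baseChange ℚ_[p]).toAffine.Point), IsIsogenous V W' ∧ P ≠ 0 ∧ p • P = 0) →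
      ∃ D : ModularParametrizationData V (V.conductorNorm ℤ), ¬ (p : ℤ) ∣ D.c) :
    TwistDegreeStepFiveSeven := by
  intro hnf p _ V _ _ _ Wf _ _ _ C hp57 hadd hirr hK hV4 hC
  by_cases hPT : ∀ (W' : WeierstrassCurve ℚ) [W'.IsElliptic] [W'.IsGloballyMinimal], IsIsogenous V W' →
      ∀ P : (W'.baseChange ℚ_[p]).toAffine.Point, p • P = 0 → P = 0
  · exact twistDegreeStep57_of_kato_of_noTorsion hF hnf V Wf C hp57 hadd hirr hK hV4 hC hPT
  · push Not at hPT
    obtain ⟨W', hE', hM', hiso, P, hP, hP0⟩ := hPT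
    obtain ⟨D, hc⟩ := hKP p V hp57 hadd hirr hK hV4 ⟨W', hE', hM', P, hiso, hP0, hP⟩
    exact ⟨D, twistDegreeStep57_of_not_dvd_c (by omega) V Wf hadd hK hV4 C hC D hc⟩

/-! ### §5 (appended) The ČNS degree sub-locus, Cremona's range, and the residue of TDS57 -/
section Slices

variable {p : ℕ} [hp : Fact p.Prime]

/-- **The step on the DEGREE sub-locus, GRANTED Česnavičius–Neururer–Saha and modularity**: a datum of
degree prime to `p` at level `N(V)` on some minimal `W' ∼ V` gives (`v_p(c) ≤ v_p(deg)`, prime-to-`p`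
transport under `Irr`) a conductor-level datum of `V` with `p ∤ c`; then §1.
[cite: CesnaviciusNeururerSaha2023, Thm. 1.2] [cite: ZagierCMB1985, §1 (p. 374)] -/
theorem twistDegreeStep57_of_cns_of_not_dvd_modularDegree (hnf : exists_isNewformOf)
    (hCNS : cesnaviciusNeururerSaha_padicVal_maninConstant_le_modularDegree)
    (V : WeierstrassCurve ℚ) [V.IsElliptic] [V.IsGloballyMinimal] [NeZero (V.conductorNorm ℤ)]
    (Wf : WeierstrassCurve ℚ) [Wf.IsElliptic] [Wf.IsGloballyMinimal] [NeZero (Wf.conductorNorm ℤ)]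
    (C : VariableChange ℚ) (hp5 : 5 ≤ p) (hadd : Addv V p) (hirr : Irr V p)
    (hK : ∀ (v : HeightOneSpectrum ℤ) (n : ℕ), natGenerator v = p →
      V.kodairaSymbolAt v ≠ KodairaSymbol.Istar n)
    (hV4 : padicValInt p V.minimalDiscriminantInt ≤ 4)
    (hC : C • V.quadraticTwist ((-1 : ℚ) ^ (p / 2) * p) = Wf)
    {W' : WeierstrassCurve ℚ} [W'.IsElliptic] [W'.IsGloballyMinimal] (hiso : IsIsogenous V W')
    (D' : ModularParametrizationData W' (V.conductorNorm ℤ)) (hdeg : ¬ p ∣ D'.modularDegree) :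
    ∃ D : ModularParametrizationData V (V.conductorNorm ℤ),
      ∀ Df : ModularParametrizationData Wf (Wf.conductorNorm ℤ),
        padicValNat p D.modularDegree < padicValNat p Df.modularDegree := by
  obtain ⟨D, hc⟩ := ManinFrameTransport.exists_modularParametrizationData_not_dvd_of_not_dvd_modularDegree
    hnf hCNS V hp.out hp5 hirr hiso D' hdeg
  exact ⟨D, twistDegreeStep57_of_not_dvd_c hp5 V Wf hadd hK hV4 C hC D hc⟩

/-- **The step in CREMONA'S RANGE `N(V) ≤ 5·10⁵`, GRANTED Cremona's table by name and modularity**: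
the optimal member has `c₀ = ±1`, transport to `V`, §1.
[cite: CesnaviciusNeururerSaha2023, §1 p. 2 and ref. [Cre22]] [cite: ZagierCMB1985, §1 (p. 374)] -/
theorem twistDegreeStep57_of_cremona_of_conductorNorm_le
    (hCre : cremona_abs_maninConstant_eq_one_of_level_le_500000) (hnf : exists_isNewformOf)
    (V : WeierstrassCurve ℚ) [V.IsElliptic] [V.IsGloballyMinimal] [NeZero (V.conductorNorm ℤ)]
    (Wf : WeierstrassCurve ℚ) [Wf.IsElliptic] [Wf.IsGloballyMinimal] [NeZero (Wf.conductorNorm ℤ)]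
    (C : VariableChange ℚ) (hp5 : 5 ≤ p) (hadd : Addv V p) (hirr : Irr V p)
    (hK : ∀ (v : HeightOneSpectrum ℤ) (n : ℕ), natGenerator v = p →
      V.kodairaSymbolAt v ≠ KodairaSymbol.Istar n)
    (hV4 : padicValInt p V.minimalDiscriminantInt ≤ 4)
    (hC : C • V.quadraticTwist ((-1 : ℚ) ^ (p / 2) * p) = Wf) (hN : V.conductorNorm ℤ ≤ 500000) :
    ∃ D : ModularParametrizationData V (V.conductorNorm ℤ),
      ∀ Df : ModularParametrizationData Wf (Wf.conductorNorm ℤ),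
        padicValNat p D.modularDegree < padicValNat p Df.modularDegree := by
  obtain ⟨W₀, hE₀, hM₀, D₀, hiso, hc₀⟩ :=
    ManinFrameResidueProperCremonaRange.exists_member_not_dvd_c_of_conductorNorm_le hCre hnf V hN p
  haveI := hE₀; haveI := hM₀
  obtain ⟨D, hc⟩ := ManinFrameTransport.exists_modularParametrizationData_not_dvd_of_partner V hp.out hirr
    hiso D₀ hc₀
  exact ⟨D, twistDegreeStep57_of_not_dvd_c hp5 V Wf hadd hK hV4 C hC D hc⟩
end Slices

/-- **TDS57 BY NAME ⟸ F″ ∧ ČNS ∧ Cremona ∧ KP57♯** (all three inputs cite-only, by name). KP57♯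
(hypothesis `hKP`; OPEN) = Manin's `p`-part, SOME conductor-level datum, for every `V` as in TDS57 such that
(a) some minimal member of its class has a `ℚ_p`-rational point of order `p` (so Kodaira II/III at `5`,
II at `7`, `kp_types_of_torsion_witness`), (b) every datum at level `N(V)` of every minimal member has
degree divisible by `p`, (c) `N(V) > 5·10⁵` — the residue of the crux after every lever in the tree.
CONDITIONAL; nothing is closed; BSD is not proved by this. [cite: Kato2004Asterisque, Thm. 9.7 (p. 189)]
[cite: CesnaviciusNeururerSaha2023, Thm. 1.2] [cite: KostersPannekoek2017, Thm. 1 and Cor. 2] -/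
theorem twistDegreeStepFiveSeven_of_kato_cns_cremona_of_kpResidue
    (hF : kato_neron_isIntegral_twistedSymbolSum_of_additive_five_le)
    (hCNS : cesnaviciusNeururerSaha_padicVal_maninConstant_le_modularDegree)
    (hCre : cremona_abs_maninConstant_eq_one_of_level_le_500000)
    (hKP : ∀ (p : ℕ) [Fact p.Prime] (V : WeierstrassCurve ℚ) [V.IsElliptic] [V.IsGloballyMinimal]
      [NeZero (V.conductorNorm ℤ)], (p = 5 ∨ p = 7) → Addv V p → Irr V p →
      (∀ (v : HeightOneSpectrum ℤ) (n : ℕ), natGenerator v = p →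
        V.kodairaSymbolAt v ≠ KodairaSymbol.Istar n) →
      padicValInt p V.minimalDiscriminantInt ≤ 4 →
      (∃ (W' : WeierstrassCurve ℚ) (_ : W'.IsElliptic) (_ : W'.IsGloballyMinimal)
        (P : (W'.baseChange ℚ_[p]).toAffine.Point), IsIsogenous V W' ∧ P ≠ 0 ∧ p • P = 0) →
      (∀ (W' : WeierstrassCurve ℚ) [W'.IsElliptic] [W'.IsGloballyMinimal]
        (D' : ModularParametrizationData W' (V.conductorNorm ℤ)),
        IsIsogenous V W' → p ∣ D'.modularDegree) →
      500000 < V.conductorNorm ℤ →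
      ∃ D : ModularParametrizationData V (V.conductorNorm ℤ), ¬ (p : ℤ) ∣ D.c) :
    TwistDegreeStepFiveSeven := by
  intro hnf p _ V _ _ _ Wf _ _ _ C hp57 hadd hirr hK hV4 hC; have hp5 : 5 ≤ p := by omega
  rcases le_or_gt (V.conductorNorm ℤ) 500000 with hN | hN
  · exact twistDegreeStep57_of_cremona_of_conductorNorm_le hCre hnf V Wf C hp5 hadd hirr hK hV4 hC hN
  by_cases hdeg : ∃ (W' : WeierstrassCurve ℚ) (_ : W'.IsElliptic) (_ : W'.IsGloballyMinimal)
      (D' : ModularParametrizationData W' (V.conductorNorm ℤ)), IsIsogenous V W' ∧ ¬ p ∣ D'.modularDegree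
  · obtain ⟨W', hE', hM', D', hiso, hd⟩ := hdeg; haveI := hE'; haveI := hM'
    exact twistDegreeStep57_of_cns_of_not_dvd_modularDegree hnf hCNS V Wf C hp5 hadd hirr hK hV4 hC hiso
      D' hd
  have hall : ∀ (W' : WeierstrassCurve ℚ) [W'.IsElliptic] [W'.IsGloballyMinimal]
      (D' : ModularParametrizationData W' (V.conductorNorm ℤ)), IsIsogenous V W' → p ∣ D'.modularDegree :=
    fun W' _ _ D' hiso ↦ by_contra fun hnd ↦ hdeg ⟨W', ‹_›, ‹_›, D', hiso, hnd⟩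
  by_cases hPT : ∀ (W' : WeierstrassCurve ℚ) [W'.IsElliptic] [W'.IsGloballyMinimal], IsIsogenous V W' →
      ∀ P : (W'.baseChange ℚ_[p]).toAffine.Point, p • P = 0 → P = 0
  · exact twistDegreeStep57_of_kato_of_noTorsion hF hnf V Wf C hp57 hadd hirr hK hV4 hC hPT
  · push Not at hPT; obtain ⟨W', hE', hM', hiso, P, hP, hP0⟩ := hPT
    obtain ⟨D, hc⟩ := hKP p V hp57 hadd hirr hK hV4 ⟨W', hE', hM', P, hiso, hP0, hP⟩ hall hN
    exact ⟨D, twistDegreeStep57_of_not_dvd_c hp5 V Wf hadd hK hV4 C hC D hc⟩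

end Summit.BirchSwinnertonDyer.BirchSwinnertonDyer.Theorems.TwistDegreeStepFiveSeven

end
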